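import Summits.AtomisticToContinuum.BoseEinsteinCondensation.Theorems.BECCutLineWeakDisorderGroundStateRigidityStubEnergyTruncAux
import HarnessLib

/-!
# Crux `GroundStateRigidity` (stmt-AtomisticToContinuum-9072), line `Sketch`:
# the registered stub `stub_energyTrunc`

Supports (does not close) stmt-AtomisticToContinuum-9072; stub `stub_energyTrunc` of line Sketch
(lead c2). **Energy truncation `E₀(v ⊓ n) ↑ E₀(v)`** for pair potentials `v` bounded on every
`[r, ∞)`, `r > 0` (arbitrary at `r → 0`), GIVEN (as hypotheses, not re-proved) the registered
statements of the neighbouring stubs `stub_pairCutoff` (a `C¹` symmetric cutoff `χ` of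
`ε`-collisions with `vol{χ ≠ 1} ≤ Aε`, `∫|∇χ|² ≤ Aε` on the box) and `stub_truncHigh` (amplitude
truncation `g` of a trial state at no kinetic cost, `|g| ≤ B`, `∫|g − Ψ|² ≤ η`).

Proof. `≤`: monotonicity of the energy in the potential. `≥`: with `E_∞ = supₙ E₀(v ⊓ n) < ⊤`
and `τ > 0`, take a near-minimiser `Ψ` of `v ⊓ n` (`n` large), its amplitude truncation `g` and
the cut state `f = χ g`: `f` is `C¹`, Dirichlet, symmetric; pointwise
`|∇f|² ≤ (1+θ)|∇g|² + (1+θ⁻¹) B² |∇χ|² 1_{Λ^N}` (IMS/Young multiplier bound) and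
`V|f|² ≤ (V ⊓ n)|Ψ|²` (on `supp χ` all pairs are `> ε` apart, where `v ≤ C_ε ≤ n`); so
`Q_v(f) ≤ (1+θ)(E_∞ + τ/8) + (1+θ⁻¹)B²Aε` (`EnergyTrunc.form_le`), while
`1 = ‖Ψ‖² ≤ (1+θ)‖f‖² + 2(1+θ⁻¹)(η + B²Aε)` (`EnergyTrunc.mass_le`). Normalising `f` gives a
trial state of `v`-energy `≤ E_∞ + τ` once `θ, η, ε` are small (`EnergyTrunc.bookkeeping`).
The helpers live in `BECCutLineWeakDisorderGroundStateRigidityStubEnergyTruncAux.lean`.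
-/

noncomputable section

open MeasureTheory Filter Set
open scoped ENNReal NNReal Topology

namespace Summit.AtomisticToContinuum.BoseEinsteinCondensation.Theorems.GroundStateRigidity

open Literature.MathematicalPhysics.QuantumManyBody.BoseGas

open EnergyTrunc in
/-- **Energy truncation `E₀(v ⊓ n) ↑ E₀(v)` for potentials bounded on every `[r, ∞)`, `r > 0`**
(registered stub `stub_energyTrunc` of line `Sketch`), given the statements of `stub_pairCutoff`
and `stub_truncHigh` as hypotheses. `≤` is monotonicity in the potential; `≥`: for `τ > 0` and
`E_∞ = supₙ E₀(v ⊓ n) < ⊤`, a near-minimiser `Ψ` of `v ⊓ n` (`n ≥ C_ε`), its amplitude truncation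
`g` (`|g| ≤ B`, `∫|g − Ψ|² ≤ η`, no kinetic cost) and the collision cutoff `χ` give the cut state
`f = χ g` with `Q_v(f) ≤ (1+θ)(E_∞ + τ/8) + (1+θ⁻¹)B²Aε` (`form_le`) and
`1 ≤ (1+θ)‖f‖² + 2(1+θ⁻¹)(η + B²Aε)` (`mass_le`); normalised, `f` is a trial state of `v`-energy
`≤ E_∞ + τ` (`bookkeeping`). [cite: ReedSimonIV1978, §XIII.12 Thm XIII.47] -/
theorem stub_energyTrunc :
    (∀ (N : ℕ) (L : ℝ), 0 < L → ∃ A : ℝ≥0, ∀ ε : ℝ, 0 < ε → ε ≤ 1 →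
      ∃ χ : Config N → ℝ, ContDiff ℝ 1 χ ∧ (∀ X, 0 ≤ χ X ∧ χ X ≤ 1) ∧
        (∀ (σ : Equiv.Perm (Fin N)) (X : Config N), χ (X ∘ σ) = χ X) ∧
        (∀ X : Config N, (∃ i j : Fin N, i ≠ j ∧ dist (X i) (X j) ≤ ε) → χ X = 0) ∧
        (∀ X : Config N, (∀ i j : Fin N, i ≠ j → 2 * ε ≤ dist (X i) (X j)) → χ X = 1) ∧
        volume {X : Config N | X ∈ boxN N L ∧ χ X ≠ 1} ≤ A * ENNReal.ofReal ε ∧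
        ∫⁻ X in boxN N L, realKinetic χ X ≤ A * ENNReal.ofReal ε) →
    (∀ (N : ℕ), 1 ≤ N → ∀ (K : ℝ≥0) (η : ℝ), 0 < η → ∃ B : ℝ≥0, ∀ (L : ℝ) (Ψ : TrialState N L),
      ∫⁻ X, kineticDensity Ψ.ψ X ≤ K →
      ∃ g : Config N → ℂ, ContDiff ℝ 1 g ∧ (∀ X, X ∉ boxN N L → g X = 0) ∧
        (∀ (σ : Equiv.Perm (Fin N)) (X : Config N), g (X ∘ σ) = g X) ∧
        (∀ X, ‖g X‖ ≤ B) ∧ (∀ X, ‖g X‖ ≤ ‖Ψ.ψ X‖) ∧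
        (∀ X, kineticDensity g X ≤ kineticDensity Ψ.ψ X) ∧
        ∫⁻ X, (‖g X - Ψ.ψ X‖₊ : ℝ≥0∞) ^ 2 ≤ ENNReal.ofReal η) →
    ∀ (N : ℕ) (v : ℝ → ℝ≥0∞) (L : ℝ), 1 ≤ N → 0 < L → Measurable v →
      (∀ r : ℝ, 0 < r → ∃ C : ℝ≥0, ∀ s : ℝ, r ≤ s → v s ≤ C) →
      ⨆ n : ℕ, groundStateEnergy (fun r => min (v r) (n : ℝ≥0∞)) N L = groundStateEnergy v N L := by
  intro hCut hTrunc N v L hN hL hv hlb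
  refine le_antisymm (iSup_le fun n => groundStateEnergy_mono (fun r => min_le_left _ _) N L) ?_
  set Einf : ℝ≥0∞ := ⨆ n : ℕ, groundStateEnergy (fun r => min (v r) (n : ℝ≥0∞)) N L
    with hEinf_def
  refine ENNReal.le_of_forall_pos_le_add fun τ hτ hfin => ?_
  -- real parameters `e = E_∞`, `t = τ`, then `θ`, `η`, `ε`
  set e : ℝ := Einf.toReal with he_def
  have he0 : 0 ≤ e := ENNReal.toReal_nonneg
  have hEe : Einf = ENNReal.ofReal e := (ENNReal.ofReal_toReal hfin.ne).symm
  set t : ℝ := (τ : ℝ) with ht_def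
  have ht : 0 < t := NNReal.coe_pos.2 hτ
  have hP : 0 < e + t + 1 := by linarith
  set θ : ℝ := t / (8 * (e + t + 1)) with hθ_def
  have hθ0 : 0 < θ := by positivity
  have hθP : θ * (e + t + 1) = t / 8 := by
    rw [hθ_def]; field_simp
  have hθ1 : θ ≤ 1 := by nlinarith
  have hM : 0 < 1 + θ⁻¹ := by positivity
  obtain ⟨A, hA⟩ := hCut N L hL
  set η : ℝ := t / (16 * (e + t + 1) * (1 + θ⁻¹)) with hη_def
  have hη0 : 0 < η := by positivity
  have hηP : (1 + θ⁻¹) * η * (e + t + 1) = t / 16 := by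
    rw [hη_def]; field_simp
  obtain ⟨B, hB⟩ := hTrunc N hN (Real.toNNReal (e + t / 8)) η hη0
  have hBA : 0 ≤ (B : ℝ) ^ 2 * A := by positivity
  set ε : ℝ := min 1 (t / (16 * (e + t + 1) * (1 + θ⁻¹) * ((B : ℝ) ^ 2 * A + 1))) with hε_def
  have hε0 : 0 < ε := lt_min one_pos (by positivity)
  have hε1 : ε ≤ 1 := min_le_left _ _
  have hεP : (1 + θ⁻¹) * ((B : ℝ) ^ 2 * A * ε) * (e + t + 1) ≤ t / 16 := by
    have h1 : ε ≤ t / (16 * (e + t + 1) * (1 + θ⁻¹) * ((B : ℝ) ^ 2 * A + 1)) := min_le_right _ _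
    rw [le_div_iff₀ (by positivity)] at h1
    nlinarith [mul_nonneg (mul_nonneg hM.le hε0.le) hP.le]
  obtain ⟨χ, hχ1, hχ01, hχσ, hχ0, -, hχvol, hχkin⟩ := hA ε hε0 hε1
  obtain ⟨C, hC⟩ := hlb ε hε0
  obtain ⟨n, hn⟩ := exists_nat_ge C
  have hCn : (C : ℝ≥0∞) ≤ (n : ℝ≥0∞) := by exact_mod_cast hn
  -- a near-minimiser `Ψ` of the truncated problem and its amplitude truncation `g`
  have hlt : groundStateEnergy (fun r => min (v r) (n : ℝ≥0∞)) N L <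
      ENNReal.ofReal (e + t / 8) := by
    calc groundStateEnergy (fun r => min (v r) (n : ℝ≥0∞)) N L ≤ Einf :=
          le_iSup (fun n : ℕ => groundStateEnergy (fun r => min (v r) (n : ℝ≥0∞)) N L) n
      _ = ENNReal.ofReal e := hEe
      _ < ENNReal.ofReal (e + t / 8) :=
          (ENNReal.ofReal_lt_ofReal_iff (by positivity)).2 (by linarith)
  obtain ⟨Ψ, hΨ⟩ := iInf_lt_iff.1 hlt
  have hkinΨ : ∫⁻ X, kineticDensity Ψ.ψ X ≤ (Real.toNNReal (e + t / 8) : ℝ≥0∞) :=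
    (lintegral_mono fun X => le_self_add).trans hΨ.le
  obtain ⟨g, hg1, hg0, hgσ, hgB, hgΨ, hgk, hgL2⟩ := hB L Ψ hkinΨ
  -- the cut state `f = χ g`
  have hV : ∀ X, χ X ≠ 0 → interaction v X = interaction (fun r => min (v r) (n : ℝ≥0∞)) X := by
    intro X hX
    refine interaction_eq_trunc hC hCn fun i j hij => ?_
    by_contra hcon
    exact hX (hχ0 X ⟨i, j, hij, not_lt.1 hcon⟩)
  have hf1 : ContDiff ℝ 1 fun X => (χ X : ℂ) * g X :=
    (Complex.ofRealCLM.contDiff.comp hχ1).mul hg1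
  have hf0 : ∀ X, X ∉ boxN N L → (χ X : ℂ) * g X = 0 := fun X hX => by
    rw [hg0 X hX, mul_zero]
  have hfσ : ∀ (σ : Equiv.Perm (Fin N)) (X : Config N),
      (χ (X ∘ σ) : ℂ) * g (X ∘ σ) = (χ X : ℂ) * g X := fun σ X => by
    rw [hχσ σ X, hgσ σ X]
  set m : ℝ≥0∞ := ∫⁻ X, (‖(χ X : ℂ) * g X‖₊ : ℝ≥0∞) ^ 2 with hm_def
  set Q : ℝ≥0∞ := ∫⁻ X, kineticDensity (fun Y => (χ Y : ℂ) * g Y) X +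
      interaction v X * (‖(χ X : ℂ) * g X‖₊ : ℝ≥0∞) ^ 2 with hQ_def
  have hm1 : m ≤ 1 := by
    calc m ≤ ∫⁻ X, (‖Ψ.ψ X‖₊ : ℝ≥0∞) ^ 2 := by
          refine lintegral_mono fun X => pow_le_pow_left' (ENNReal.coe_le_coe.2
            ((nnnorm_cut_le hχ01 g X).trans ?_)) 2
          rw [← NNReal.coe_le_coe, coe_nnnorm, coe_nnnorm]
          exact hgΨ X
      _ = 1 := Ψ.norm_eq
  have hmt : m ≠ ⊤ := ne_top_of_le_ne_top ENNReal.one_ne_top hm1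
  -- the form bound and the mass bound, transported to `ℝ`
  have hR1 : ENNReal.ofReal ((1 + θ) * (e + t / 8) + (1 + θ⁻¹) * ((B : ℝ) ^ 2 * A * ε)) =
      ENNReal.ofReal (1 + θ) * ENNReal.ofReal (e + t / 8) +
        ENNReal.ofReal (1 + θ⁻¹) * (B : ℝ≥0∞) ^ 2 * (A * ENNReal.ofReal ε) := by
    rw [ENNReal.ofReal_add (by positivity : (0 : ℝ) ≤ (1 + θ) * (e + t / 8))
        (by positivity : (0 : ℝ) ≤ (1 + θ⁻¹) * ((B : ℝ) ^ 2 * A * ε)),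
      ENNReal.ofReal_mul (by positivity : (0 : ℝ) ≤ 1 + θ),
      ENNReal.ofReal_mul (by positivity : (0 : ℝ) ≤ 1 + θ⁻¹),
      ENNReal.ofReal_mul (by positivity : (0 : ℝ) ≤ (B : ℝ) ^ 2 * A),
      ENNReal.ofReal_mul (by positivity : (0 : ℝ) ≤ (B : ℝ) ^ 2), ← coe_nnreal_sq,
      ENNReal.ofReal_coe_nnreal]
    ring
  have hQle : Q ≤ ENNReal.ofReal ((1 + θ) * (e + t / 8) + (1 + θ⁻¹) * ((B : ℝ) ^ 2 * A * ε)) := by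
    rw [hR1]
    calc Q ≤ _ := form_le hv Ψ hg1 hg0 hgB hgΨ hgk hχ1 hχ01 hV hθ0
      _ ≤ _ := add_le_add (mul_le_mul' le_rfl hΨ.le) (mul_le_mul' le_rfl hχkin)
  have hQt : Q ≠ ⊤ := ne_top_of_le_ne_top ENNReal.ofReal_ne_top hQle
  have hq : Q.toReal ≤ (1 + θ) * (e + t / 8) + (1 + θ⁻¹) * ((B : ℝ) ^ 2 * A * ε) :=
    ENNReal.toReal_le_of_le_ofReal (by positivity) hQle
  have hR2 : ENNReal.ofReal ((1 + θ) * m.toReal + 2 * (1 + θ⁻¹) * (η + (B : ℝ) ^ 2 * (A * ε))) =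
      ENNReal.ofReal (1 + θ) * m + ENNReal.ofReal (2 * (1 + θ⁻¹)) *
        (ENNReal.ofReal η + (B : ℝ≥0∞) ^ 2 * (A * ENNReal.ofReal ε)) := by
    rw [ENNReal.ofReal_add (by positivity : (0 : ℝ) ≤ (1 + θ) * m.toReal)
        (by positivity : (0 : ℝ) ≤ 2 * (1 + θ⁻¹) * (η + (B : ℝ) ^ 2 * (A * ε))),
      ENNReal.ofReal_mul (by positivity : (0 : ℝ) ≤ 1 + θ), ENNReal.ofReal_toReal hmt,
      ENNReal.ofReal_mul (by positivity : (0 : ℝ) ≤ 2 * (1 + θ⁻¹)),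
      ENNReal.ofReal_add hη0.le (by positivity : (0 : ℝ) ≤ (B : ℝ) ^ 2 * (A * ε)),
      ENNReal.ofReal_mul (by positivity : (0 : ℝ) ≤ (B : ℝ) ^ 2),
      ENNReal.ofReal_mul (A.coe_nonneg : (0 : ℝ) ≤ A), ← coe_nnreal_sq,
      ENNReal.ofReal_coe_nnreal]
  have hμle : (1 : ℝ≥0∞) ≤ ENNReal.ofReal ((1 + θ) * m.toReal +
      2 * (1 + θ⁻¹) * (η + (B : ℝ) ^ 2 * (A * ε))) := by
    rw [hR2]
    calc (1 : ℝ≥0∞) ≤ _ := mass_le Ψ hg1 hg0 hgB hχ1 hχ01 hθ0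
      _ ≤ _ := add_le_add le_rfl
          (mul_le_mul' le_rfl (add_le_add hgL2 (mul_le_mul' le_rfl hχvol)))
  have hμ : 1 ≤ (1 + θ) * m.toReal +
      2 * ((1 + θ⁻¹) * η + (1 + θ⁻¹) * ((B : ℝ) ^ 2 * A * ε)) := by
    have := ENNReal.one_le_ofReal.1 hμle
    linarith
  -- bookkeeping
  obtain ⟨hμ0, hqμ⟩ := bookkeeping he0 ht hθ0 hθ1 hθP.le (by positivity) hεP (by positivity)
    hηP.le hq hμ
  have hm0 : m ≠ 0 := fun h => by
    rw [h, ENNReal.toReal_zero] at hμ0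
    exact lt_irrefl 0 hμ0
  -- the normalised cut state is a trial state of energy `≤ E_∞ + τ`
  obtain ⟨Θ, hΘ⟩ := exists_trialState_energy_le hf1 hf0 hfσ hm0 hmt v
  calc groundStateEnergy v N L ≤ energy v Θ := groundStateEnergy_le_energy v Θ
    _ ≤ m⁻¹ * Q := hΘ
    _ ≤ m⁻¹ * (m * ENNReal.ofReal (e + t)) := by
        gcongr
        rw [← ENNReal.ofReal_toReal hQt, ← ENNReal.ofReal_toReal hmt,
          ← ENNReal.ofReal_mul ENNReal.toReal_nonneg]
        exact ENNReal.ofReal_le_ofReal hqμ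
    _ = ENNReal.ofReal (e + t) := by
        rw [← mul_assoc, ENNReal.inv_mul_cancel hm0 hmt, one_mul]
    _ = Einf + τ := by
        rw [ENNReal.ofReal_add he0 ht.le, ← hEe, ht_def, ENNReal.ofReal_coe_nnreal]

end Summit.AtomisticToContinuum.BoseEinsteinCondensation.Theorems.GroundStateRigidity

end
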